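import Literature.AlgebraicGeometry.AbelianSchemes.IsLambdaOfAtSquareRoot
import Literature.AlgebraicGeometry.AbelianSchemes.AbelianSchemeIsLambdaOfAtBaseChange
import Literature.AlgebraicGeometry.AbelianSchemes.AbelianSchemePolarizationBaseChange
import Literature.AlgebraicGeometry.AbelianSchemes.AbelianSchemeDualTransportOfBaseChange
import Literature.AlgebraicGeometry.AbelianSchemes.DualPairFibreDim
import Literature.AlgebraicGeometry.AbelianSchemes.PolarizationKernelSubsetKTheta
import Literature.AlgebraicGeometry.AbelianSchemes.AbelianSchemeLDeltaHalfPicZero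
import Literature.AlgebraicGeometry.AbelianSchemes.AbelianSchemeKOfLFibres
import Literature.AlgebraicGeometry.AbelianSchemes.AbelianSchemeOverCommOfReduced
import Literature.AlgebraicGeometry.AbelianSchemes.AbelianSchemeOverFibreDim
import Literature.AlgebraicGeometry.AbelianVarieties.LineBundleTensorPower
import Literature.AlgebraicGeometry.AbelianVarieties.HomogeneousLineBundleDivisor
import Literature.AlgebraicGeometry.Motives.CartierDivisorAmple
import HarnessLib

/-!
# The (V) POLARIZATION CLOSER: over the `L^Δ`-cube locus `H₅` the descended homomorphism `ω₅` IS A POLARIZATION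
# ([MumfordFogartyKirwan1994] Prop. 7.3 step (V): «`Z₅ = Z₄ ×_{H₄} H₅` carries the polarization `ω̄₅` with `L′₅ ≅ L^Δ(ω̄₅)^3`»)

Layer `Literature/AlgebraicGeometry/AbelianSchemes`, namespace `Literature.AlgebraicGeometry.AbelianSchemes.AbelianSchemeOver`.
THEOREMS ONLY (no definition, no named fact, no instance, no notation, no `sorry`).  Cell hodgecm-mathlib (D-0151), F-DAG leaf F-6 (V)
(B-plan1 (g16) 08:37:01Z; census `B-provers/B-p03/g18/CENSUS-V-PolarizationCloser.B-p03g18.md`).  HC_CM is proved only modulo the 7 printed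
citations until rung 0 closes; nothing here is about HC.

CONTEXT.  ★ `LDeltaCubeLocus.exists_descended_hom_cube` / `exists_classify_and_LDelta_cube_locus` ([MFK] Prop. 7.3 (V) via Prop. 6.11) produce,
from an abelian scheme `A/S` with dual pair `D = (Â, 𝒫)` and a rank-one `L` on `A` classified by `lam = Λ(L) : A → Â`, the closed subscheme
`j : H₅ ↪ S` together with THE homomorphism `ω₅ : A_{H₅} → Â_{H₅}` with `[6] ≫ ω₅ = Λ(L) ×_S H₅` and `L|_{A_{H₅}} ≅ (Γ₁^*𝒫)^{⊗3} = L^Δ(ω₅)^{⊗3}` —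
the homomorphism-form stand-in for MFK's «`Z₅` carries the polarization `ω̄₅`».  This file upgrades the stand-in to an honest ★ `Polarization`
(Def. 6.3: homomorphism + `Λ(ample)` at every geometric point): the `pol` binder of the F-6 tower (★ `PolarizedLevelLocusTower`), of step (VI)
and of the F-8 `classify` at the universal object over `H₅`.

* §1 **`IsLambdaOfAt.of_pow_succ_smul`** — THE `n`-TH ROOT OF `Λ`: `λ̄ⁿ = Λ(𝒪(n•Θ))` ⇒ `λ̄ = Λ(𝒪(Θ))` at a geometric point (`n ≠ 0` in `Ω`;
  ★ G4 `IsLambdaOfAt.of_sq_two_smul` is `n = 2`); `IsLambdaOfAt.sq_of_pow_six_three_smul` — the cube root `λ̄⁶ = Λ(𝒪(3•Θ))` ⇒ `λ̄² = Λ(𝒪(Θ))`.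
* §2 `exists_isAmple_isLambdaOfAt_of_pow_six_of_three_smul` — the (V) step at a geometric point over a REDUCED Noetherian base: ★ G4 ed. 2
  `exists_isAmple_isLambdaOfAt_of_pow_six_of_sq` + §1 + a non-zero section of an odd multiple of the ample `Θ₆` (★
  `CartierDivisor.IsAmple.exists_forall_le_isSection_ne_zero` — no effectivity hypothesis).
* §3 **`exists_polarization_lam_eq_of_polarization_pow_six`** — over ANY base `T`: «a sixth root `ω` of a POLARIZATION whose `Λ`-class is
  fibrewise divisible by `3` is a polarization» (`dim Ê_t = g`, residue characteristics `0`).  No reducedness / Noetherianity / connectedness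
  of `T`: the statement is moved to the base `Spec Ω` of each geometric point (★ `IsLambdaOfAt.baseChange` / `of_baseChange`, ★
  `Polarization.baseChange`, ★ `nonempty_unitHatSlice_baseChange_iso`, ★ `isCommMonObj_of_field`; onto-ness of `ω̄` from the isogeny
  `[6] ≫ ω̄`, ★ `Polarization.exists_comp_lam_eq_of_dim_eq`), where §2 applies, and moved back.
* §4 **`exists_polarization_lam_eq_of_fibrewise_ample`** — `Λ(L)` of a fibrewise-AMPLE rank-one `L` is a polarization (any base; ★
  `isLambdaOfAt_of_classify_mumfordBundle`).
* §5 `exists_isLambdaOfAt_pow_six_three_smul_of_iso_tensorPow` — `[6] ≫ ω = Λ(L) ×_S T` and `L|_{A_T} ≅ M^{⊗3}` ⇒ `ω̄⁶ = Λ(𝒪(3•Θ_Δ))` at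
  every geometric point of `T` (class bookkeeping in `Ȟ¹`, ★ `detClass_tensorPow`, ★ `cechClass_divisorBaseChange`).
* §6 **`exists_polarization_lam_eq_of_LDelta_cube`** — THE CLOSER in the letter of ★ (γ): over a base `S ⟶ Spec F` locally of finite type,
  `F` countable of characteristic `0` (the Hilbert-scheme piece over `ℚ`), `A` of relative dimension `g` (`dim Â_s = g`, ★ (D1)
  `Polarization.dim_hat_fibre_eq_of_locallyOfFiniteType`), `L` fibrewise ample: **`∃ pol : (A.baseChange b).Polarization (D.baseChange b),
  pol.lam = ω`**.  The consumer plugs `L := L′` (normalised), `b := j`, `ω := ω₅`, `M := Γ₁^*𝒫`.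

## References
* [MumfordFogartyKirwan1994] D. Mumford, J. Fogarty, F. Kirwan, *Geometric Invariant Theory*, 3rd ed. (1994), Ch. 6 §2 Def. 6.2–6.3 (p. 120),
  Prop. 6.10–6.11 (pp. 121–123), Ch. 7 §2 Def. 7.2 (p. 129), Prop. 7.3 step (V) (p. 134).
* [MumfordAV1970] D. Mumford, *Abelian Varieties* (1970), §6 Cor. 4 (p. 59), §8 Thm. 1 (p. 77) and pp. 74–75, §23 Thm. 3 (p. 231).
* [GortzWedhorn2020] U. Görtz, T. Wedhorn, *Algebraic Geometry I* (2nd ed., 2020), Section (4.7), (4.7.1) (p. 108).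
* [Hartshorne1977] R. Hartshorne, *Algebraic Geometry* (1977), II Ex. 6.11.
-/

noncomputable section

universe u

open CategoryTheory CategoryTheory.Limits AlgebraicGeometry MonoidalCategory Cardinal

namespace Literature.AlgebraicGeometry.AbelianSchemes

open Literature.AlgebraicGeometry.Motives Literature.AlgebraicGeometry.AbelianVarieties Literature.AlgebraicGeometry.Modules
open scoped MonObj

namespace AbelianSchemeOver

variable {S : Scheme.{u}} (A : AbelianSchemeOver S) (D : A.DualPair) {Ω : Type u} [Field Ω] (s : Spec (.of Ω) ⟶ S)

/-! ## §1 The `n`-th root of `Λ`: `λ̄ⁿ = Λ(𝒪(n•Θ))` ⇒ `λ̄ = Λ(𝒪(Θ))` -/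

/-- `[D_{Q^{n+1}}(Θ)] = [D_Q(Θ)]^{n+1}` in `Ȟ¹` (theorem of the square ★ `weilDiv_mul_linEquiv`, iterated).
[cite: MumfordAV1970, §6 Cor. 4 (p. 59) and §8 (pp. 74–75)] -/
theorem cechClass_weilDiv_pow_succ (X : AbelianVariety Ω) (Θ : CartierDivisor X.X.left) (Q : X.Points Ω) :
    ∀ n : ℕ, (X.weilDiv Θ (Q ^ (n + 1))).cechClass = (X.weilDiv Θ Q).cechClass ^ (n + 1)
  | 0 => by rw [zero_add, pow_one, pow_one]
  | n + 1 => by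
    rw [pow_succ Q (n + 1), (CartierDivisor.cechClass_eq_iff_linEquiv _ _).2 (X.weilDiv_mul_linEquiv Θ (Q ^ (n + 1)) Q),
      CartierDivisor.cechClass_add, cechClass_weilDiv_pow_succ X Θ Q n, ← pow_succ]

/-- **THE `n`-TH ROOT OF `Λ`: `λ̄ⁿ = Λ(𝒪(n•Θ))` at `s` ⇒ `λ̄ = Λ(𝒪(Θ))` at `s`** (`Ω` algebraically closed, `n ≠ 0` in `Ω`): for
`P = Qⁿ` (★ divisibility `exists_pow_eq_of_isAlgClosed`) the slice at `λ̄(P) = λ̄ⁿ(Q)` (★ `sliceAt_pow`) is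
`t_Q^*𝒪(nΘ) ⊗ 𝒪(nΘ)⁻¹`, and `D_Q(n•Θ) ∼ n•D_Q(Θ) ∼ D_{Qⁿ}(Θ)`; ★ (D-2) dictionary.  (G4 `IsLambdaOfAt.of_sq_two_smul` is `n = 2`;
the hom `λ̄ − Λ(Θ)` out of the divisible `A_s(Ω)` is killed by `n`, hence trivial — [MumfordAV1970] §23.)
[cite: MumfordAV1970, §23 Thm. 3 (p. 231)] [cite: MumfordFogartyKirwan1994, Ch. 6 §2 Definition 6.2–6.3 (p. 120)] -/
theorem IsLambdaOfAt.of_pow_succ_smul [IsAlgClosed Ω] {n : ℕ} (hn : ((n + 1 : ℕ) : Ω) ≠ 0) {lam : A.X ⟶ D.hat.X} [IsMonHom lam]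
    {Θ₁ : CartierDivisor (A.fibre s).toAbelianVariety.X.left} (h : A.IsLambdaOfAt s D (lam ^ (n + 1)) ((n + 1) • Θ₁)) :
    A.IsLambdaOfAt s D lam Θ₁ := by
  intro P
  obtain ⟨Q, hQ⟩ := (A.fibre s).toAbelianVariety.exists_pow_eq_of_isAlgClosed (n + 1) hn P
  -- the slice at `λ̄(P)` is the slice at `λ̄ⁿ⁺¹(Q)`
  have hsl : A.sliceAt s D lam P = A.sliceAt s D (lam ^ (n + 1)) Q := by rw [A.sliceAt_pow D lam s Q (n + 1), hQ]
  obtain ⟨i⟩ := h Q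
  -- `D_P(Θ₁) ∼ D_Q((n+1)•Θ₁)`
  have hlin : ((A.fibre s).toAbelianVariety.weilDiv ((n + 1) • Θ₁) Q).LinEquiv ((A.fibre s).toAbelianVariety.weilDiv Θ₁ P) := by
    rw [← hQ, ← CartierDivisor.cechClass_eq_iff_linEquiv, cechClass_weilDiv_pow_succ, cechClass_weilDiv, cechClass_weilDiv,
      cechClass_smul', map_pow, ← inv_pow, ← mul_pow]
  obtain ⟨j⟩ := (weilDiv_linEquiv_iff_nonempty_translateTensorDual_iso (A.fibre s).toAbelianVariety Θ₁ ((n + 1) • Θ₁) P Q).1 hlin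
  refine ⟨?_ ≪≫ i ≪≫ j⟩
  exact (Scheme.Modules.pullbackCongr hsl).app D.P

/-- The cube root, in the shape the (V) step consumes: `λ̄⁶ = Λ(𝒪(3•Θ))` ⇒ `λ̄² = Λ(𝒪(Θ))` (`(λ̄²)³ = λ̄⁶`, `3 ≠ 0`).
[cite: MumfordAV1970, §23 Thm. 3 (p. 231)] [cite: MumfordFogartyKirwan1994, Ch. 6 §2 Definition 6.2–6.3 (p. 120)] -/
theorem IsLambdaOfAt.sq_of_pow_six_three_smul [IsAlgClosed Ω] (h3 : (3 : Ω) ≠ 0) [IsCommMonObj D.hat.X] {lam : A.X ⟶ D.hat.X}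
    [IsMonHom lam] {Θ : CartierDivisor (A.fibre s).toAbelianVariety.X.left} (h : A.IsLambdaOfAt s D (lam ^ 6) (3 • Θ)) :
    A.IsLambdaOfAt s D (lam ^ 2) Θ := by
  haveI : IsMonHom (lam ^ 2) := isMonHom_pow D.hat lam 2
  have h' : A.IsLambdaOfAt s D ((lam ^ 2) ^ (2 + 1)) ((2 + 1) • Θ) := by
    rw [← pow_mul]; exact h
  exact IsLambdaOfAt.of_pow_succ_smul A D s (n := 2) (by norm_num; exact h3) h'

/-! ## §2 The (V) step at a geometric point over a reduced Noetherian base, from `λ̄⁶ = Λ(ample)` and `λ̄⁶ = Λ(3•Θ_Δ)` -/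

section Core

variable [IsAlgClosed Ω] [CharZero Ω] [IsReduced S] [IsLocallyNoetherian S]
  (hD : Nonempty ((Scheme.Modules.pullback (DualPair.unitHatSlice D)).obj D.P ≅ SheafOfModules.unit _))

include hD in
/-- **The (V) step at a geometric point** (over a reduced locally Noetherian base; characteristic `0`): if `λ̄⁶ = Λ(𝒪(Θ₆))` with
`Θ₆` AMPLE, `λ̄⁶ = Λ(𝒪(3•Θ_Δ))` for some `Θ_Δ`, and `λ̄` is onto on `Ω`-points, then `λ̄ = Λ(𝒪(Θ))` for an AMPLE `Θ` — `λ` is a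
polarization at `s` ([MumfordFogartyKirwan1994] Def. 6.3).  ★ G4 `exists_isAmple_isLambdaOfAt_of_pow_six_of_sq` after the cube root
`IsLambdaOfAt.sq_of_pow_six_three_smul` (`λ̄² = Λ(𝒪(Θ_Δ))`) and a non-zero section of an odd multiple of the ample `Θ₆` (★
`CartierDivisor.IsAmple.exists_forall_le_isSection_ne_zero`). [cite: MumfordFogartyKirwan1994, Ch. 7 §2 Prop. 7.3 step (V) (p. 134)]
[cite: MumfordFogartyKirwan1994, Ch. 6 §2 Definition 6.3 (p. 120)] [cite: MumfordAV1970, §23 Thm. 3 (p. 231)] -/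
theorem exists_isAmple_isLambdaOfAt_of_pow_six_of_three_smul [IsCommMonObj D.hat.X] {lam : A.X ⟶ D.hat.X} [IsMonHom lam]
    (hsurj : ∀ y : D.hat.FibrePoints s, ∃ x : A.FibrePoints s, x ≫ lam = y)
    {Θ₆ ΘΔ : CartierDivisor (A.fibre s).toAbelianVariety.X.left} (hamp : Θ₆.IsAmple)
    (h6 : A.IsLambdaOfAt s D (lam ^ 6) Θ₆) (hΔ : A.IsLambdaOfAt s D (lam ^ 6) (3 • ΘΔ)) :
    ∃ Θ : CartierDivisor (A.fibre s).toAbelianVariety.X.left, Θ.IsAmple ∧ A.IsLambdaOfAt s D lam Θ := by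
  have h3 : (3 : Ω) ≠ 0 := by exact_mod_cast (show (3 : ℕ) ≠ 0 by decide)
  obtain ⟨n₀, hn₀⟩ := hamp.exists_forall_le_isSection_ne_zero
  obtain ⟨s₀, hsec, hs₀⟩ := hn₀ (2 * n₀ + 1) (by omega)
  exact A.exists_isAmple_isLambdaOfAt_of_pow_six_of_sq D s hD hsurj hamp (N := 2 * n₀ + 1) ⟨n₀, rfl⟩ hs₀ hsec h6
    (IsLambdaOfAt.sq_of_pow_six_three_smul A D s h3 hΔ)

end Core

/-! ## §3 The (V) step over ANY base: «a sixth root `ω` of a polarization with `Λ`-class fibrewise divisible by `3` is a polarization» -/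

open scoped CategoryTheory.Obj in
/-- A monoidal functor between cartesian-monoidal categories maps powers in `Hom(X, M)` (Mathlib's `Hom.monoid` for a monoid
object `M`) to powers for the transported monoid structure (Mathlib `Functor.homMonoidHom`; pattern of ★ `map_id_pow'`).
[cite: GortzWedhorn2020, Section (4.7), (4.7.1) (p. 108)] -/
theorem map_pow_of_monoidal {C C' : Type*} [Category C] [Category C'] [CartesianMonoidalCategory C]
    [CartesianMonoidalCategory C'] (F : C ⥤ C') [F.Monoidal] {X M : C} [MonObj M] (f : X ⟶ M) (N : ℕ) :
    F.map (f ^ N) = (F.map f) ^ N := by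
  rw [← F.homMonoidHom_apply, map_pow, F.homMonoidHom_apply]

section AnyBase

variable {T : Scheme.{u}} (B : AbelianSchemeOver T) (E : B.DualPair)
  (hE : Nonempty ((Scheme.Modules.pullback (DualPair.unitHatSlice E)).obj E.P ≅ SheafOfModules.unit _))
  (polT : B.Polarization E) (ω : B.X ⟶ E.hat.X) [IsMonHom ω] (hpol : polT.lam = ((𝟙 B.X) ^ 6) ≫ ω)
  {g : ℕ} (hB : B.IsOfRelDim g)
  (hdim : ∀ ⦃Ω : Type u⦄ [Field Ω] (t : Spec (.of Ω) ⟶ T), (E.hat.fibre t).toAbelianVariety.dim = g)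
  (hΔ : ∀ ⦃Ω : Type u⦄ [Field Ω] [IsAlgClosed Ω] (t : Spec (.of Ω) ⟶ T),
    ∃ ΘΔ : CartierDivisor (B.fibre t).toAbelianVariety.X.left, B.IsLambdaOfAt t E (ω ^ 6) (3 • ΘΔ))
  (hchar : ∀ ⦃Ω : Type u⦄ [Field Ω] (_ : Spec (.of Ω) ⟶ T), CharZero Ω)

include hE hpol hB hdim hΔ hchar in
/-- **THE (V) STEP AT A GEOMETRIC POINT OVER ANY BASE.**  Let `B/T` be an abelian scheme of relative dimension `g` with dual pair `E`
(unit hypothesis `hE`), `dim Ê_t = g` at all field-valued points, residue characteristics `0`; let `ω : B → Ê` be a homomorphism such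
that `[6] ≫ ω` is a POLARIZATION (`polT`) and `ω̄⁶ = Λ(𝒪(3•Θ_Δ))` at every geometric point.  Then at every geometric point `t`,
`ω̄ = Λ(𝒪(Θ))` for an AMPLE `Θ`.  No reducedness / Noetherianity / connectedness is asked of `T`: the statement is moved to the base
`Spec Ω` of the point (★ `IsLambdaOfAt.baseChange`, ★ `Polarization.baseChange`, ★ `nonempty_unitHatSlice_baseChange_iso`, ★
`isCommMonObj_of_field`), where §2 applies (`Spec Ω` is reduced and Noetherian; onto-ness of `ω̄` from the isogeny `[6] ≫ ω`, ★
`Polarization.exists_comp_lam_eq_of_dim_eq`), and moved back (★ `IsLambdaOfAt.of_baseChange`).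
[cite: MumfordFogartyKirwan1994, Ch. 7 §2 Prop. 7.3 step (V) (p. 134)] [cite: MumfordFogartyKirwan1994, Ch. 6 §2 Definition 6.3 (p. 120) and Ch. 7 §2 Definition 7.2 (p. 129)]
[cite: MumfordAV1970, §23 Thm. 3 (p. 231)] -/
theorem exists_isAmple_isLambdaOfAt_of_polarization_pow_six ⦃Ω : Type u⦄ [Field Ω] [IsAlgClosed Ω] (t : Spec (.of Ω) ⟶ T) :
    ∃ Θ : CartierDivisor (B.fibre t).toAbelianVariety.X.left, Θ.IsAmple ∧ B.IsLambdaOfAt t E ω Θ := by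
  haveI : CharZero Ω := hchar t
  -- the point `u₀ = 𝟙` of the new base `Spec Ω`, the base changes along `t`
  let u₀ : Spec (.of Ω) ⟶ Spec (.of Ω) := 𝟙 _
  let ω' : (B.baseChange t).X ⟶ (E.baseChange t).hat.X := (Over.pullback t).map ω
  haveI : IsMonHom ω' := Functor.map.instIsMonHom _ _ ω
  haveI : IsCommMonObj (E.baseChange t).hat.X := (E.baseChange t).hat.isCommMonObj_of_field
  have hE' : Nonempty ((Scheme.Modules.pullback (DualPair.unitHatSlice (E.baseChange t))).obj (E.baseChange t).P ≅
      SheafOfModules.unit _) := DualPair.nonempty_unitHatSlice_baseChange_iso E hE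
  let polΩ : (B.baseChange t).Polarization (E.baseChange t) := polT.baseChange t
  have hlamΩ : polΩ.lam = ((𝟙 (B.baseChange t).X) ^ 6) ≫ ω' := by
    change (Over.pullback t).map polT.lam = _
    have h1 : (Over.pullback t).map ((𝟙 B.X) ^ 6) = (𝟙 (B.baseChange t).X) ^ 6 :=
      (map_pow_of_monoidal (Over.pullback t) (𝟙 B.X) 6).trans (by rw [CategoryTheory.Functor.map_id]; rfl)
    rw [hpol, Functor.map_comp, h1]
    rfl
  have hω6 : ((𝟙 (B.baseChange t).X) ^ 6) ≫ ω' = ω' ^ 6 := by rw [MonObj.pow_comp, Category.id_comp]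
  -- `ω̄'⁶ = Λ(ample)` at `u₀`: the polarization `[6] ≫ ω`, base-changed
  obtain ⟨Θ₆, hamp₆, h6⟩ := polΩ.exists_ample Ω u₀
  rw [hlamΩ, hω6] at h6
  -- `ω̄'⁶ = Λ(𝒪(3•Θ_Δ))` at `u₀`: transported from the point `u₀ ≫ t` of `T`
  obtain ⟨ΘΔ, hΘΔ⟩ := hΔ (u₀ ≫ t)
  have hΔ' : (B.baseChange t).IsLambdaOfAt u₀ (E.baseChange t) (ω' ^ 6) (3 • B.divisorBaseChange t u₀ ΘΔ) := by
    have h := IsLambdaOfAt.baseChange B t E u₀ (ω ^ 6) (3 • ΘΔ) hΘΔ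
    have hmap : (Over.pullback t).map (ω ^ 6) = ω' ^ 6 := map_pow_of_monoidal (Over.pullback t) ω 6
    rw [hmap] at h
    haveI := B.isIso_toSchemeHom_fibreBaseChangeIso t u₀
    rwa [divisorBaseChange, CartierDivisor.pullback_smul] at h
  -- `ω̄'` is onto on `Ω`-points at `u₀`: `[6] ≫ ω̄'` is (an isogeny, equal dimensions)
  have hdimΩ : ((B.baseChange t).fibre u₀).toAbelianVariety.dim = ((E.baseChange t).hat.fibre u₀).toAbelianVariety.dim := by
    rw [dim_fibre_of_isOfRelDim (hB.baseChange t) u₀, DualPair.dim_hat_fibre_baseChange_eq E t hdim u₀]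
  haveI := polΩ.isMonHom
  have hsurjΩ : ∀ y : (E.baseChange t).hat.FibrePoints u₀, ∃ x : (B.baseChange t).FibrePoints u₀, x ≫ ω' = y := fun y => by
    obtain ⟨x, hx⟩ := polΩ.exists_comp_lam_eq_of_dim_eq u₀ hdimΩ y
    refine ⟨x ^ 6, ?_⟩
    rw [hlamΩ, ← Category.assoc, MonObj.comp_pow, Category.comp_id] at hx
    exact hx
  -- §2 over `Spec Ω`
  obtain ⟨Θ, hΘ, hΛ⟩ := (B.baseChange t).exists_isAmple_isLambdaOfAt_of_pow_six_of_three_smul (E.baseChange t) u₀ hE' hsurjΩ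
    hamp₆ h6 hΔ'
  -- back along `t`, to the point `u₀ ≫ t = t`
  have hback := IsLambdaOfAt.of_baseChange B t E u₀ ω Θ hΛ
  haveI := B.isIso_toSchemeHom_fibreBaseChangeIso_inv t u₀
  have key : ∃ Θ' : CartierDivisor (B.fibre (𝟙 (Spec (.of Ω)) ≫ t)).toAbelianVariety.X.left,
      Θ'.IsAmple ∧ B.IsLambdaOfAt (𝟙 (Spec (.of Ω)) ≫ t) E ω Θ' :=
    ⟨_, hΘ.pullback _, hback⟩
  rw [Category.id_comp] at key
  exact key

include hE hpol hB hdim hΔ hchar in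
/-- **A SIXTH ROOT OF A POLARIZATION WITH `Λ`-CLASS FIBREWISE DIVISIBLE BY `3` IS A POLARIZATION** (any base `T`): under the
hypotheses of `exists_isAmple_isLambdaOfAt_of_polarization_pow_six` there is a polarization `pol` of `B/T` with respect to `E` with
`pol.lam = ω` ([MumfordFogartyKirwan1994] Def. 6.3: homomorphism + `Λ(ample)` at every geometric point).
[cite: MumfordFogartyKirwan1994, Ch. 6 §2 Definition 6.3 (p. 120)] [cite: MumfordFogartyKirwan1994, Ch. 7 §2 Prop. 7.3 step (V) (p. 134)] -/
theorem exists_polarization_lam_eq_of_polarization_pow_six : ∃ pol : B.Polarization E, pol.lam = ω :=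
  ⟨⟨ω, inferInstance, fun _ _ _ t =>
    B.exists_isAmple_isLambdaOfAt_of_polarization_pow_six E hE polT ω hpol hB hdim hΔ hchar t⟩, rfl⟩

end AnyBase

/-! ## §4 `Λ(L)` of a fibrewise-ample rank-one `L` IS a polarization -/

section LambdaOfAmple

variable {L : A.left.Modules} (hL : HasRank L 1) (lam : A.X ⟶ D.hat.X)
  (hlam : ∀ ⦃U : Over S⦄ (u : U ⟶ A.X),
    Nonempty ((Scheme.Modules.pullback (A.X ◁ (u ≫ lam)).left).obj D.P ≅
      (Scheme.Modules.pullback (A.X ◁ u).left).obj (A.mumfordBundle L)))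

include hL hlam in
/-- `Λ(L)` is `Λ(𝒪(Θ))` at `s` for THE divisor `Θ` of `L|_{A_s}` (★ `isLambdaOfAt_of_classify_mumfordBundle`, the classifying
hypothesis in the Mathlib-native whisker spelling of ★ `exists_isMonHom_classify_mumfordBundle_of_isLocallyNoetherian_base`, bridged by
★ `DualPair.pullbackP_eq_pullback_whiskerLeft`; the class identity from the isomorphism, ★ `cechPic_pullback_fst_detClass_eq_of_iso`).
[cite: MumfordFogartyKirwan1994, Ch. 6 §2 Definition 6.2 (p. 120)] [cite: MumfordAV1970, §8 (pp. 74–75)] -/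
theorem isLambdaOfAt_of_classify_mumfordBundle_of_iso {Θ : CartierDivisor (A.fibre s).toAbelianVariety.X.left}
    (e : (Scheme.Modules.pullback (X := (A.fibre s).toAbelianVariety.X.left) (pullback.fst A.X.hom s)).obj L ≅
      A.lineBundleOfDivisor s Θ) :
    A.IsLambdaOfAt s D lam Θ :=
  A.isLambdaOfAt_of_classify_mumfordBundle D hL lam (fun U u => by rw [D.pullbackP_eq_pullback_whiskerLeft]; exact hlam u) s
    (A.cechPic_pullback_fst_detClass_eq_of_iso s hL e)

include hL hlam in
/-- **`Λ(L)` OF A FIBREWISE-AMPLE RANK-ONE `L` IS A POLARIZATION** ([MumfordFogartyKirwan1994] Def. 6.3; any base): if the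
homomorphism `lam : A → Â` classifies the Mumford family of `L` and at every geometric point `s` the restriction `L|_{A_s}` is `𝒪(Θ)`
for an AMPLE `Θ`, then `lam` underlies a polarization. [cite: MumfordFogartyKirwan1994, Ch. 6 §2 Definition 6.3 (p. 120)]
[cite: MumfordAV1970, §8 (pp. 74–75) and §6 Application 1 (p. 60)] -/
theorem exists_polarization_lam_eq_of_fibrewise_ample [IsMonHom lam]
    (hamp : ∀ ⦃Ω : Type u⦄ [Field Ω] [IsAlgClosed Ω] (s : Spec (.of Ω) ⟶ S),
      ∃ Θ : CartierDivisor (A.fibre s).toAbelianVariety.X.left, Θ.IsAmple ∧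
        Nonempty ((Scheme.Modules.pullback (X := (A.fibre s).toAbelianVariety.X.left) (pullback.fst A.X.hom s)).obj L ≅
          A.lineBundleOfDivisor s Θ)) :
    ∃ pol : A.Polarization D, pol.lam = lam :=
  ⟨⟨lam, inferInstance, fun _ _ _ s => by
    obtain ⟨Θ, hΘ, ⟨e⟩⟩ := hamp s
    exact ⟨Θ, hΘ, A.isLambdaOfAt_of_classify_mumfordBundle_of_iso D s hL lam hlam e⟩⟩, rfl⟩

/-! ## §5 `L|_{A_T} ≅ M^{⊗3}` and `[6] ≫ ω = Λ(L)_T` ⇒ `ω̄⁶ = Λ(𝒪(3•Θ_Δ))` at every geometric point of `T` -/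

include hL hlam in
/-- **The cube datum at a geometric point**: over `b : T ⟶ S`, if `[6] ≫ ω = Λ(L) ×_S T` and `L|_{A_T} ≅ M^{⊗3}` for a rank-one `M`
on `A_T`, then at every geometric point `t` of `T`, `ω̄⁶ = Λ(𝒪(3•Θ_Δ))` for THE divisor `Θ_Δ` of `M|_{(A_T)_t}`: `Λ(L)` is
`Λ(𝒪(Θ))` at `t ≫ b` for the divisor `Θ` of `L|_{A_{t ≫ b}}` (§4), base change along `b` (★ `IsLambdaOfAt.baseChange`), and the class
bookkeeping `[e^*Θ] = e^*[L_{t≫b}] = [L_T|_t] = [M_t]^3 = [3•Θ_Δ]` in `Ȟ¹((A_T)_t, 𝒪^×)` (★ `detClass_tensorPow`, ★ `detClass_pullback`,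
★ `cechClass_divisorBaseChange`, ★ `fibreBaseChangeIso_hom_toSchemeHom_fst`; ★ `IsLambdaOfAt.of_linEquiv`).
[cite: MumfordFogartyKirwan1994, Ch. 7 §2 Prop. 7.3 step (V) (p. 134)] [cite: MumfordFogartyKirwan1994, Ch. 6 §2 Definition 6.2 (p. 120)]
[cite: Hartshorne1977, II Ex. 6.11] -/
theorem exists_isLambdaOfAt_pow_six_three_smul_of_iso_tensorPow {T : Scheme.{u}} (b : T ⟶ S)
    (ω : (A.baseChange b).X ⟶ (D.hat.baseChange b).X) [IsMonHom ω]
    (hω : ((𝟙 (A.baseChange b).X) ^ 6) ≫ ω = (Over.pullback b).map lam)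
    {M : (A.baseChange b).left.Modules} (hM : HasRank M 1)
    (hLM : Nonempty ((Scheme.Modules.pullback (pullback.fst A.X.hom b)).obj L ≅ tensorPow M 3))
    ⦃Ω : Type u⦄ [Field Ω] [IsAlgClosed Ω] (t : Spec (.of Ω) ⟶ T) :
    ∃ ΘΔ : CartierDivisor ((A.baseChange b).fibre t).toAbelianVariety.X.left,
      (A.baseChange b).IsLambdaOfAt t (D.baseChange b) (ω ^ 6) (3 • ΘΔ) := by
  -- `Λ(L) = Λ(𝒪(Θ))` at `t ≫ b`, and its base change along `b`
  obtain ⟨Θ, ⟨e⟩, hcl, hΛ⟩ := A.exists_isLambdaOfAt_of_classify_mumfordBundle D hL lam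
    (fun U u => by rw [D.pullbackP_eq_pullback_whiskerLeft]; exact hlam u) (t ≫ b)
  have h1 := IsLambdaOfAt.baseChange A b D t lam Θ hΛ
  have hω' : (Over.pullback b).map lam = ω ^ 6 :=
    hω.symm.trans ((MonObj.pow_comp (𝟙 (A.baseChange b).X) 6 ω).trans (by rw [Category.id_comp]; rfl))
  rw [hω'] at h1
  -- THE divisor `Θ_Δ` of `M|_{(A_T)_t}`
  have hMt : HasRank ((Scheme.Modules.pullback (X := ((A.baseChange b).fibre t).toAbelianVariety.X.left)
      (pullback.fst (A.baseChange b).X.hom t)).obj M) 1 := hasRank_pullback _ hM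
  obtain ⟨ΘΔ, ⟨eΔ⟩⟩ := exists_iso_lineBundle_toUnitCocycle hMt
  refine ⟨ΘΔ, IsLambdaOfAt.of_linEquiv (A.baseChange b) (D.baseChange b) t (ω ^ 6) ?_ h1⟩
  -- classes in `Ȟ¹((A_T)_t, 𝒪^×)`
  have hcomp : AbelianVariety.Hom.toSchemeHom (A.fibreBaseChangeIso b t).hom ≫ pullback.fst A.X.hom (t ≫ b) =
      (pullback.fst (A.baseChange b).X.hom t : ((A.baseChange b).fibre t).toAbelianVariety.X.left ⟶ (A.baseChange b).left) ≫
        pullback.fst A.X.hom b :=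
    A.fibreBaseChangeIso_hom_toSchemeHom_fst b t
  have hLf : IsFiniteLocallyFree L := HasRank.isFiniteLocallyFree' hL
  have hMf : IsFiniteLocallyFree M := HasRank.isFiniteLocallyFree' hM
  -- `[L|_{A_T}] = [M]^3` on `A_T`
  have hLT : CechPic.pullback (pullback.fst A.X.hom b) (detClass hLf) = detClass hMf ^ 3 := by
    rw [← detClass_pullback (pullback.fst A.X.hom b) hLf]
    exact (detClass_eq_of_iso hLM.some (hLf.pullback _) (isFiniteLocallyFree_tensorPow hMf 3)).trans
      (detClass_tensorPow hM hMf 3 _)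
  -- `[M|_{(A_T)_t}] = [Θ_Δ]` on the fibre
  have hMΘ : CechPic.pullback (X := ((A.baseChange b).fibre t).toAbelianVariety.X.left) (pullback.fst (A.baseChange b).X.hom t)
      (detClass hMf) = ΘΔ.cechClass := by
    rw [← detClass_pullback _ hMf, detClass_eq_of_iso eΔ (hMf.pullback _) ΘΔ.toUnitCocycle.isFiniteLocallyFree_lineBundle,
      detClass_lineBundle_toUnitCocycle]
  rw [← CartierDivisor.cechClass_eq_iff_linEquiv, cechClass_divisorBaseChange, hcl.symm, ← CechPic.pullback_comp, hcomp,
    cechClass_smul', ← hMΘ, ← map_pow]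
  exact (CechPic.pullback_comp _ _ _).trans (congrArg _ hLT)

end LambdaOfAmple

/-! ## §6 THE (V) POLARIZATION CLOSER over the `L^Δ`-cube locus -/

/-- Over a base of characteristic zero the geometric points have characteristic zero (a field `Ω` with `Spec Ω → T → S → Spec F`,
`CharZero F`, receives a ring map `F → Ω`). [cite: GortzWedhorn2020, Section (4.7), (4.7.1) (p. 108)] -/
theorem charZero_of_specMap_comp {F : Type u} [Field F] [CharZero F] (f : S ⟶ Spec (.of F)) {Ω : Type u} [Field Ω]
    (s : Spec (.of Ω) ⟶ S) : CharZero Ω :=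
  charZero_of_injective_ringHom (f := (Spec.preimage (s ≫ f)).hom) (RingHom.injective _)

/-- **THE (V) POLARIZATION CLOSER** ([MumfordFogartyKirwan1994] Prop. 7.3 step (V): «`Z₅ = Z₄ ×_{H₄} H₅` carries the polarization `ω̄₅`
with `L′₅ ≅ L^Δ(ω̄₅)^3`»), in the letter of ★ `LDeltaCubeLocus.exists_descended_hom_cube` / `exists_classify_and_LDelta_cube_locus`:
let `A/S` be an abelian scheme of relative dimension `g` over a base `S` locally of finite type over a countable field `F` of
characteristic `0`, with dual pair `D` (unit hypothesis `hD`), `L` a rank-one module on `A` whose Mumford family is classified by the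
homomorphism `lam = Λ(L)` and which is fibrewise AMPLE (`hamp`: `L|_{A_s} ≅ 𝒪(Θ)`, `Θ` ample, at geometric points); let `b : T ⟶ S`
and `ω : A_T → Â_T` a homomorphism with `[6] ≫ ω = Λ(L) ×_S T` and `L|_{A_T} ≅ M^{⊗3}` for a rank-one `M` (over `H₅`: `ω = ω₅`,
`M = Γ₁^*𝒫`).  Then **`ω` underlies a POLARIZATION of `A_T`** (Def. 6.3: `ω̄ = Λ(ample)` at every geometric point): the `pol` binder of
the F-6 tower / (VI) / F-8 `classify` at the universal object over `H₅`.  Assembly: §4 (`Λ(L)` is a polarization) ⇒ its base change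
`[6] ≫ ω` is one; §5 (the cube datum); `dim Â = g` at field-valued points (★ `Polarization.dim_hat_fibre_eq_of_locallyOfFiniteType`,
★ `DualPair.dim_hat_fibre_baseChange_eq`); residue characteristics `0`; §3.
[cite: MumfordFogartyKirwan1994, Ch. 7 §2 Prop. 7.3 step (V) (p. 134)] [cite: MumfordFogartyKirwan1994, Ch. 6 §2 Definition 6.3 (p. 120)]
[cite: MumfordAV1970, §23 Thm. 3 (p. 231) and §8 Thm. 1 (p. 77)] -/
theorem exists_polarization_lam_eq_of_LDelta_cube {F : Type} [Field F] [CharZero F] (hF : #F ≤ ℵ₀)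
    {S T : Scheme.{0}} (f : S ⟶ Spec (.of F)) [LocallyOfFiniteType f] (A : AbelianSchemeOver S) (D : A.DualPair)
    (hD : Nonempty ((Scheme.Modules.pullback (DualPair.unitHatSlice D)).obj D.P ≅ SheafOfModules.unit _))
    {g : ℕ} (hA : A.IsOfRelDim g) {L : A.left.Modules} (hL : HasRank L 1) (lam : A.X ⟶ D.hat.X) [IsMonHom lam]
    (hlam : ∀ ⦃U : Over S⦄ (u : U ⟶ A.X),
      Nonempty ((Scheme.Modules.pullback (A.X ◁ (u ≫ lam)).left).obj D.P ≅
        (Scheme.Modules.pullback (A.X ◁ u).left).obj (A.mumfordBundle L)))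
    (hamp : ∀ ⦃Ω : Type⦄ [Field Ω] [IsAlgClosed Ω] (s : Spec (.of Ω) ⟶ S),
      ∃ Θ : CartierDivisor (A.fibre s).toAbelianVariety.X.left, Θ.IsAmple ∧
        Nonempty ((Scheme.Modules.pullback (X := (A.fibre s).toAbelianVariety.X.left) (pullback.fst A.X.hom s)).obj L ≅
          A.lineBundleOfDivisor s Θ))
    (b : T ⟶ S) (ω : (A.baseChange b).X ⟶ (D.hat.baseChange b).X) [IsMonHom ω]
    (hω : ((𝟙 (A.baseChange b).X) ^ 6) ≫ ω = (Over.pullback b).map lam)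
    {M : (A.baseChange b).left.Modules} (hM : HasRank M 1)
    (hLM : Nonempty ((Scheme.Modules.pullback (pullback.fst A.X.hom b)).obj L ≅ tensorPow M 3)) :
    ∃ pol : (A.baseChange b).Polarization (D.baseChange b), pol.lam = ω := by
  obtain ⟨polL, hpolL⟩ := A.exists_polarization_lam_eq_of_fibrewise_ample D hL lam hlam hamp
  haveI : IsMonHom (show (A.baseChange b).X ⟶ (D.baseChange b).hat.X from ω) := by assumption
  have hpol : (polL.baseChange b).lam = ((𝟙 (A.baseChange b).X) ^ 6) ≫ ω := by
    rw [Polarization.baseChange_lam, hpolL]; exact hω.symm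
  have hdimS : ∀ ⦃Ω : Type⦄ [Field Ω] (s : Spec (.of Ω) ⟶ S), (D.hat.fibre s).toAbelianVariety.dim = g :=
    fun Ω _ s => polL.dim_hat_fibre_eq_of_locallyOfFiniteType hA hF f s
  exact (A.baseChange b).exists_polarization_lam_eq_of_polarization_pow_six (D.baseChange b)
    (DualPair.nonempty_unitHatSlice_baseChange_iso D hD) (polL.baseChange b) ω hpol (hA.baseChange b)
    (fun Ω _ t => DualPair.dim_hat_fibre_baseChange_eq D b hdimS t)
    (fun Ω _ _ t => A.exists_isLambdaOfAt_pow_six_three_smul_of_iso_tensorPow D hL lam hlam b ω hω hM hLM t)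
    (fun Ω _ t => charZero_of_specMap_comp f (t ≫ b))

end AbelianSchemeOver

end Literature.AlgebraicGeometry.AbelianSchemes
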